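import Literature.AlgebraicGeometry.Resolution.ProjHomogeneousIdealSheaf
import Literature.AlgebraicGeometry.Resolution.AffineBlowupIntegral
import Mathlib.AlgebraicGeometry.Morphisms.ClosedImmersion
import Mathlib.RingTheory.Ideal.Quotient.Nilpotent
import Mathlib.RingTheory.Nilpotent.Lemmas
import Mathlib.Algebra.Squarefree.Basic
import HarnessLib

/-!
# The closed subscheme `V(Ĩ) ⊆ Proj A` of a homogeneous ideal is reduced when `A ⧸ I` is

Topic: `Literature/AlgebraicGeometry/Resolution`. Complement to `ProjHomogeneousIdealSheaf.lean` (the ideal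
sheaf `Ĩ = projIdealSheaf 𝒜 I` of a homogeneous ideal `I ≤ A`, defined as the kernel ideal sheaf of the closed
immersion `Proj (A ⧸ I) → Proj A`) and to `AffineBlowupIntegral.lean` (`Proj.isReduced`: `Proj` of a reduced
graded ring is reduced).

* `isClosedImmersion_projMap_quotGradedHom` — `Proj (A ⧸ I) → Proj A` is a closed immersion (the graded
  quotient map is surjective; `FundamentalGroup.isClosedImmersion_projMap_of_surjective`);
* `isReduced_subscheme_projIdealSheaf` — **if `A ⧸ I` is reduced then the closed subscheme `V(Ĩ)` of `Proj A` is
  reduced**: `V(Ĩ)` is the scheme-theoretic image of the closed immersion `Proj (A ⧸ I) → Proj A`, hence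
  isomorphic to `Proj (A ⧸ I)` (Mathlib: `IsIso f.toImage` for a closed immersion `f`), which is reduced by
  `Proj.isReduced` (Hartshorne II Prop. 5.9 / Ex. 3.12 with Ex. 2.3: reducedness is stalk-local and the stalks of
  `Proj` are homogeneous localizations);
* `isReduced_subscheme_projIdealSheaf_of_isRadical` — the same from `I` radical;
* `isReduced_subscheme_projIdealSheaf_span_singleton_of_squarefree` — **a squarefree homogeneous element `f` of
  a graded ring with unique factorisation (a decomposition monoid) cuts out a REDUCED hypersurface `V₊(f)`**
  (squarefree ⇒ radical, Mathlib `Squarefree.isRadical`); the case of one squarefree form in `κ₀[T₀,…,T_m]` is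
  the reduced hypersurface of `ℙ^m_{κ₀}`.

Everything is proved; no named facts.

## References

* R. Hartshorne, *Algebraic Geometry*, GTM 52 (1977): II Prop. 5.9, Ex. 2.3, Ex. 3.12, Ex. 5.10. [Hartshorne1977]
* The Stacks Project, Tag 01M3 (= Lemma 27.8.*: `Proj` and homogeneous localization). [StacksProject]
-/

noncomputable section

open CategoryTheory AlgebraicGeometry HomogeneousLocalization TopologicalSpace

universe u

namespace Literature.AlgebraicGeometry.Resolution

section HomogeneousIdeal

open Literature.RingTheory.GradedAlgebra

variable {R A : Type u} [CommRing R] [CommRing A] [Algebra R A] (𝒜 : ℕ → Submodule R A)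
  [GradedAlgebra 𝒜]

/-- **`Proj (A ⧸ I) → Proj A` is a closed immersion** (the graded quotient map is surjective).
[cite: Hartshorne1977, II Ex. 3.12] -/
theorem isClosedImmersion_projMap_quotGradedHom (I : HomogeneousIdeal 𝒜) :
    IsClosedImmersion
      (Proj.map (quotGradedHom 𝒜 I.toIdeal) (irrelevant_quotGrading_le_map 𝒜 I)) :=
  Literature.AlgebraicGeometry.FundamentalGroup.isClosedImmersion_projMap_of_surjective _ _
    (quotGradedHom_surjective 𝒜 I.toIdeal)

/-- **`V(Ĩ) ⊆ Proj A` is reduced when `A ⧸ I` is reduced**: the closed subscheme of the ideal sheaf `Ĩ` of the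
homogeneous ideal `I` is the scheme-theoretic image of the closed immersion `Proj (A ⧸ I) → Proj A`, hence
isomorphic to `Proj (A ⧸ I)`, and `Proj` of a reduced graded ring is reduced.
[cite: Hartshorne1977, II Prop. 5.9 and Ex. 2.3] -/
theorem isReduced_subscheme_projIdealSheaf (I : HomogeneousIdeal 𝒜) [IsReduced (A ⧸ I.toIdeal)] :
    IsReduced (projIdealSheaf 𝒜 I).subscheme := by
  haveI : IsClosedImmersion
      (Proj.map (quotGradedHom 𝒜 I.toIdeal) (irrelevant_quotGrading_le_map 𝒜 I)) :=
    isClosedImmersion_projMap_quotGradedHom 𝒜 I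
  haveI : IsReduced (Proj (quotGrading 𝒜 I.toIdeal)) := Proj.isReduced _
  -- `V(Ĩ)` is, by definition of `Ĩ`, the scheme-theoretic image of `Proj (A ⧸ I) → Proj A`
  show IsReduced (Proj.map (quotGradedHom 𝒜 I.toIdeal) (irrelevant_quotGrading_le_map 𝒜 I)).image
  exact isReduced_of_isOpenImmersion
    (inv (Proj.map (quotGradedHom 𝒜 I.toIdeal) (irrelevant_quotGrading_le_map 𝒜 I)).toImage)

/-- `V(Ĩ) ⊆ Proj A` is reduced when the homogeneous ideal `I` is radical.
[cite: Hartshorne1977, II Prop. 5.9 and Ex. 2.3] -/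
theorem isReduced_subscheme_projIdealSheaf_of_isRadical (I : HomogeneousIdeal 𝒜)
    (hI : I.toIdeal.IsRadical) : IsReduced (projIdealSheaf 𝒜 I).subscheme :=
  haveI := (Ideal.isRadical_iff_quotient_reduced I.toIdeal).mp hI
  isReduced_subscheme_projIdealSheaf 𝒜 I

/-- **A squarefree homogeneous element cuts out a reduced hypersurface**: in a graded ring with unique
factorisation (a decomposition monoid), for `f` squarefree generating a homogeneous ideal `(f)`, the closed
subscheme `V₊(f) = V((f)~) ⊆ Proj A` is reduced (`(f)` is a radical ideal). The case `A = κ₀[T₀,…,T_m]`, `f` one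
squarefree form, is the reduced hypersurface `V₊(f) ⊆ ℙ^m_{κ₀}`.
[cite: Hartshorne1977, II Ex. 5.10 and Ex. 2.3] -/
theorem isReduced_subscheme_projIdealSheaf_span_singleton_of_squarefree [DecompositionMonoid A] {f : A}
    (hf : Squarefree f) (hI : (Ideal.span ({f} : Set A)).IsHomogeneous 𝒜) :
    IsReduced (projIdealSheaf 𝒜 ⟨Ideal.span {f}, hI⟩).subscheme :=
  isReduced_subscheme_projIdealSheaf_of_isRadical 𝒜 _ (isRadical_iff_span_singleton.mp hf.isRadical)

end HomogeneousIdeal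

end Literature.AlgebraicGeometry.Resolution

end
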